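import Summits.Ventures.PercRepro.RankLevelSetExplicitLin2CoreMult

/-!
# PercRepro — THE CORE CELL FOR ANY MULTIPLICITY WITH THE `(Y)`-TAIL AS A HYPOTHESIS (p9, S4)

`proofs/SUBCLAIM-S4-p9.md` §S4.2⁗‴. `c025_core_lin2_of_poly_mult` (RankLevelSetExplicitLin2CoreMult) discharges the `(Y)`-side
`8·(#{ρ ≤ q} + #{spanning}) ≤ 2^n` through `16·Σ_{j ≤ q+d} C(n, j) ≤ 2^n` from the tail condition `2d + 3q + 5 ≤ p`
(`sixteen_mul_sum_range_choose_le` at `K = q + d`, `n ≥ 3K + 5`). Here the binomial-tail inequality itself is the hypothesis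
`hT`, so that any sharper tail lemma (e.g. `n ≥ (9/4)K + c`) plugs into the same core without a re-derivation; everything
else is the proof of `c025_core_lin2_of_poly_mult` verbatim. Axioms: standard.
-/

open scoped Matroid

namespace PercRepro

namespace ThmN

open Set

variable {α : Type}

/-- **THE CORE CELL FOR ANY MULTIPLICITY, WITH THE `(Y)`-TAIL AS A HYPOTHESIS**: the `e`-free core at level
`q ≥ 8`, corank `q + 1 ≤ d ≤ q + 2^q`, with `16·Σ_{j ≤ q+d} C(p+d, j) ≤ 2^{p+d}` (`hT`), satisfies `RLS M p q` as soon as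
`(P_d)` holds with the weights of the multiplicity `mult`: `8·(C(p+d, q) + W_s·A + W_b·B) ≤ 7·2^{d−q}·C(p+q, q)` for
`W_s = Σ_{j < d−q} C(μ_s − 1, j)/mult(j+1)`, `W_b = Σ_{j < d−q} C(μ_b − 1, j)/mult(j+1)`, every `A` with `6A ≤ A6(q, d, p+d)`
and every `B ≤ C((q+3)d + 2q − 2, q)` — provided the level count `hmul` holds with the factor `mult (m − q)` (night-1's
`ncard_eRk_eq_ncard_eq_mul_le` is `mult = id`; p4's cubic / quartic counts are the instances of interest). -/
theorem c025_core_lin2_of_poly_mult_tail (q : ℕ) (hq : 8 ≤ q) (M : Matroid α) [M.Finite] (p d : ℕ)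
    (hd1 : q + 1 ≤ d) (hd2 : d ≤ q + 2 ^ q)
    (hT : 16 * ∑ j ∈ Finset.range (q + d + 1), (p + d).choose j ≤ 2 ^ (p + d))
    (mult : ℕ → ℕ) (hmult : ∀ v, 1 ≤ v → 1 ≤ mult v)
    (hmul : ∀ (f f' : ℕ), (∀ C, M.IsCircuit C → 3 ≤ C.encard) → (∀ L ⊆ M.E, M.eRk L = 2 → L.ncard ≤ 3) →
      (∀ P ⊆ M.E, M.eRk P ≤ 3 → P.ncard ≤ 6) →
      (∀ X ⊆ M.E, M.eRk X ≤ q → X.ncard ≤ f) → (∀ X ⊆ M.E, M.eRk X ≤ ((q - 1 : ℕ) : ℕ∞) → X.ncard ≤ f') →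
      M.E.encard = M.eRank + d →
      ∀ m, mult (m - q) * {B : Set α | B ⊆ M.E ∧ M.eRk B = q ∧ B.ncard = m}.ncard ≤
        Nat.choose (f' - q) (m - (q + 1)) *
          (∑ k ∈ Finset.Icc 3 (q + 1), {C | M.IsCircuit C ∧ C.ncard = k}.ncard * M.E.ncard.choose (q + 1 - k)) +
        Nat.choose (f - (q + 1)) (m - (q + 1)) *
          (∑ k ∈ Finset.Icc 3 (q + 1), {C | M.IsCircuit C ∧ C.ncard = k}.ncard * ((q + 1) * d).choose (q + 1 - k)))
    (hpoly : ∀ (A B : ℕ) (Ws Wb : ℚ),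
      Ws = ∑ j ∈ Finset.range (d - q),
        (((min (5 * 2 ^ (q - 4) - q) d - 1).choose j : ℕ) : ℚ) / ((mult (j + 1) : ℕ) : ℚ) →
      Wb = ∑ j ∈ Finset.range (d - q),
        (((min (5 * 2 ^ (q - 3) - q - 1) d - 1).choose j : ℕ) : ℚ) / ((mult (j + 1) : ℕ) : ℚ) →
      6 * A ≤ 3 * (d * (d + 1)) * (p + d).choose (q - 2) + 2 * (d * (d + 1) * (d + 2)) * (p + d).choose (q - 3) +
        6 * ((2 * d + 2 * q - 2).choose 4 * (2 * d + 2 * q - 6 + (p + d)).choose (q - 4)) →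
      B ≤ ((q + 3) * d + 2 * q - 2).choose q →
      8 * (((p + d).choose q : ℚ) + Ws * A + Wb * B) ≤ 7 * 2 ^ (d - q) * ((p + q).choose q : ℚ))
    (hR : M.eRank = (p : ℕ∞)) (hn : M.E.ncard = p + d)
    (hfree : ∀ e ∈ M.E, ∃ A ⊆ M.E \ {e}, e ∉ M.closure A ∧ e ∉ M.closure ((M.E \ {e}) \ A)) :
    RLS M p q := by
  classical
  have hx := Explicit.le_two_pow_sub_four q (by omega)
  obtain ⟨h8, h16, hq3, h23⟩ := Explicit.two_pow_facts2 q hq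
  have hEcard : M.ground_finite.toFinset.card = p + d := by
    rw [← Set.ncard_eq_toFinset_card _ M.ground_finite]; exact hn
  -- the core is simple: every circuit has `≥ 3` elements
  have hL : ∀ e ∈ M.E, ¬ M.IsLoop e := not_isLoop_of_free M hfree
  have hs : ∀ e ∈ M.E, ∀ f ∈ M.E, e ≠ f → M.eRk {e, f} = 2 := by
    intro e he f hf hef
    have h2 : (2 : ℕ∞) ≤ M.eRk {e, f} :=
      two_le_eRk_of_two_le_ncard_of_free M hfree (pair_subset he hf) (by rw [ncard_pair hef])
    have h3 : M.eRk {e, f} ≤ 2 := by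
      have := M.eRk_le_encard {e, f}
      rwa [encard_pair hef] at this
    exact le_antisymm h3 h2
  have hcirc : ∀ C, M.IsCircuit C → 3 ≤ C.encard := three_le_encard_of_circuit M hL hs
  have hd : M.E.encard = M.eRank + d := by
    rw [hR, ← M.ground_finite.cast_ncard_eq, hn]
    push_cast
    ring
  -- the nullity cap: every `X ⊆ E` has `|X| ≤ r(X) + d`
  have hcap : ∀ X ⊆ M.E, ∀ k : ℕ, M.eRk X ≤ k → X.ncard ≤ k + d := by
    intro X hX k hr
    have h1 := Matroid.encard_le_eRk_add_of_encard_eq hX hd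
    have h2 : X.encard ≤ (k : ℕ∞) + d := h1.trans (by gcongr)
    have hfin : X.Finite := M.ground_finite.subset hX
    rw [← hfin.cast_ncard_eq] at h2
    exact_mod_cast h2
  -- the flat bounds: rank-`≤ q` sets have `≤ f := min (5·2^{q−3} − 1) (q + d)` points, rank-`≤ q−1` sets
  -- `≤ f' := min (5·2^{q−4} − 1) (q − 1 + d)` points (the catalogue bound and the cap)
  set f : ℕ := min (5 * 2 ^ (q - 3) - 1) (q + d) with hfdef
  set f' : ℕ := min (5 * 2 ^ (q - 4) - 1) (q - 1 + d) with hf'def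
  have hflat : ∀ X ⊆ M.E, M.eRk X ≤ q → X.ncard ≤ f := by
    intro X hX hr
    exact le_min (ncard_le_five_two_pow_of_eRk_le_of_free M hfree q (by omega) X hX hr) (hcap X hX q hr)
  have hflat' : ∀ X ⊆ M.E, M.eRk X ≤ ((q - 1 : ℕ) : ℕ∞) → X.ncard ≤ f' := by
    intro X hX hr
    refine le_min ?_ (hcap X hX (q - 1) hr)
    have := ncard_le_five_two_pow_of_eRk_le_of_free M hfree (q - 1) (by omega) X hX hr
    rwa [show q - 1 - 3 = q - 4 by omega] at this
  -- the weight indices: `f' − q + 1 = μs := min (5·2^{q−4} − q) d`, `f − q = μb := min (5·2^{q−3} − q − 1) d`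
  set μs : ℕ := min (5 * 2 ^ (q - 4) - q) d with hμsdef
  set μb : ℕ := min (5 * 2 ^ (q - 3) - q - 1) d with hμbdef
  have hμs : f' - q + 1 = μs := by
    rw [hf'def, hμsdef]
    rcases le_total (5 * 2 ^ (q - 4) - 1) (q - 1 + d) with h | h
    · rw [min_eq_left h, min_eq_left (by omega)]; omega
    · rw [min_eq_right h, min_eq_right (by omega)]; omega
  have hμb : f - q = μb := by
    rw [hfdef, hμbdef]
    rcases le_total (5 * 2 ^ (q - 3) - 1) (q + d) with h | h
    · rw [min_eq_left h, min_eq_left (by omega)]; omega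
    · rw [min_eq_right h, min_eq_right (by omega)]; omega
  have hfq : q + 1 ≤ f := by rw [hfdef]; exact le_min (by omega) (by omega)
  have hf'q : q ≤ f' := by rw [hf'def]; exact le_min (by omega) (by omega)
  -- (U): the multiplicity count
  have hU1 := Matroid.topCount_le_ncard_compl (M := M) hR hd q
  have hsum := Matroid.ncard_eRk_eq_ncard_le_le_sum (M := M) q d
  -- the circuit counts: Lemma T, Lemma T4, LEMMA `T_k`
  have hC1 : ∀ L ⊆ M.E, M.eRk L = 2 → L.ncard ≤ 3 :=
    fun L hL' hr => ncard_le_three_of_eRk_two M hs hfree hL' hr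
  have hs3 : 2 * {C | M.IsCircuit C ∧ C.ncard = 3}.ncard ≤ d * (d + 1) := S1.two_mul_ncard_triangles_le M hC1 hd
  have hC1' : ∀ L ⊆ M.E, M.eRk L ≤ 2 → L.ncard ≤ 3 := by
    intro L hL' hr
    have := ncard_add_one_le_two_pow_of_eRk_le M hL hfree 2 L hL' hr
    omega
  have hC2 : ∀ P ⊆ M.E, M.eRk P ≤ 3 → P.ncard ≤ 6 :=
    fun P hP hr => ncard_le_six_of_eRk_le_three_of_free M hfree hP hr
  have hmul' := hmul f f' hcirc hC1 hC2 hflat hflat' hd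
  have hs4 : 3 * {C : Set α | M.IsCircuit C ∧ C.ncard = 4}.ncard ≤ d * (d + 1) * (d + 2) :=
    S1.three_mul_ncard_four_circuits_le M hC1' hC2 hd
  have hsp : ∀ j : ℕ, ∀ X ⊆ M.E, M.eRk X ≤ j → X.ncard + 1 ≤ 2 ^ j :=
    fun j X hX hr => ncard_add_one_le_two_pow_of_eRk_le M hL hfree j X hX hr
  have hcsT : ∀ k, 1 ≤ k → {C | M.IsCircuit C ∧ C.ncard = k}.ncard ≤ 2 ^ (k - 1) * (d + k - 2).choose (k - 1) :=
    fun k hk => Matroid.ncard_circuits_le_two_pow_mul_choose_of_free M hd hsp k hk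
  -- the two class sums, bounded
  set A : ℕ := ∑ k ∈ Finset.Icc 3 (q + 1), {C | M.IsCircuit C ∧ C.ncard = k}.ncard * M.E.ncard.choose (q + 1 - k)
    with hAdef
  set B : ℕ := ∑ k ∈ Finset.Icc 3 (q + 1), {C | M.IsCircuit C ∧ C.ncard = k}.ncard * ((q + 1) * d).choose (q + 1 - k)
    with hBdef
  have hA : 6 * A ≤ 3 * (d * (d + 1)) * (p + d).choose (q - 2) + 2 * (d * (d + 1) * (d + 2)) * (p + d).choose (q - 3) +
      6 * ((2 * d + 2 * q - 2).choose 4 * (2 * d + 2 * q - 6 + (p + d)).choose (q - 4)) := by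
    rw [hAdef, hn, Explicit.sum_Icc_three_split q (by omega), show q + 1 - 3 = q - 2 by omega,
      show q + 1 - 4 = q - 3 by omega]
    have h5 : ∑ k ∈ Finset.Icc 5 (q + 1), {C | M.IsCircuit C ∧ C.ncard = k}.ncard * (p + d).choose (q + 1 - k) ≤
        (2 * d + 2 * q - 2).choose 4 * (2 * d + 2 * q - 6 + (p + d)).choose (q - 4) := by
      refine (Finset.sum_le_sum (fun k hk => Nat.mul_le_mul_right _ (hcsT k (by rw [Finset.mem_Icc] at hk; omega)))).trans ?_
      exact Explicit.tail_sum_le_sparse q d (p + d) (by omega)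
    have e3 : 6 * ({C | M.IsCircuit C ∧ C.ncard = 3}.ncard * (p + d).choose (q - 2)) ≤
        3 * (d * (d + 1)) * (p + d).choose (q - 2) := by
      calc 6 * ({C | M.IsCircuit C ∧ C.ncard = 3}.ncard * (p + d).choose (q - 2))
          = 3 * ((2 * {C | M.IsCircuit C ∧ C.ncard = 3}.ncard) * (p + d).choose (q - 2)) := by ring
        _ ≤ 3 * ((d * (d + 1)) * (p + d).choose (q - 2)) := Nat.mul_le_mul_left _ (Nat.mul_le_mul_right _ hs3)
        _ = 3 * (d * (d + 1)) * (p + d).choose (q - 2) := by ring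
    have e4 : 6 * ({C | M.IsCircuit C ∧ C.ncard = 4}.ncard * (p + d).choose (q - 3)) ≤
        2 * (d * (d + 1) * (d + 2)) * (p + d).choose (q - 3) := by
      calc 6 * ({C | M.IsCircuit C ∧ C.ncard = 4}.ncard * (p + d).choose (q - 3))
          = 2 * ((3 * {C | M.IsCircuit C ∧ C.ncard = 4}.ncard) * (p + d).choose (q - 3)) := by ring
        _ ≤ 2 * ((d * (d + 1) * (d + 2)) * (p + d).choose (q - 3)) := Nat.mul_le_mul_left _ (Nat.mul_le_mul_right _ hs4)
        _ = 2 * (d * (d + 1) * (d + 2)) * (p + d).choose (q - 3) := by ring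
    have e5 := Nat.mul_le_mul_left 6 h5
    omega
  have hB : B ≤ ((q + 3) * d + 2 * q - 2).choose q := by
    rw [hBdef]
    refine (Finset.sum_le_sum (fun k hk => Nat.mul_le_mul_right _ (hcsT k (by rw [Finset.mem_Icc] at hk; omega)))).trans ?_
    have h := Explicit.tail_sum_le_sparse_all q d ((q + 1) * d)
    have e : 2 * d + 2 * q - 2 + (q + 1) * d = (q + 3) * d + 2 * q - 2 := by
      have : (q + 3) * d = (q + 1) * d + 2 * d := by ring
      omega
    rwa [e] at h
  -- the level counts in `ℚ`, weighted by `1/mult(m − q)`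
  have hlevel : ∀ m ∈ Finset.Icc (q + 1) d, ({X : Set α | X ⊆ M.E ∧ M.eRk X = q ∧ X.ncard = m}.ncard : ℚ) ≤
      (((f' - q).choose (m - (q + 1)) : ℚ) * (A : ℚ) + ((f - (q + 1)).choose (m - (q + 1)) : ℚ) * (B : ℚ)) /
        ((mult (m - q) : ℕ) : ℚ) := by
    intro m hm
    rw [Finset.mem_Icc] at hm
    have hpos : (0 : ℚ) < ((mult (m - q) : ℕ) : ℚ) := by
      have := hmult (m - q) (by omega)
      exact_mod_cast (by omega : 0 < mult (m - q))
    rw [le_div_iff₀ hpos]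
    have h := hmul' m
    have h' : (((mult (m - q)) * {X : Set α | X ⊆ M.E ∧ M.eRk X = q ∧ X.ncard = m}.ncard : ℕ) : ℚ) ≤
        (((f' - q).choose (m - (q + 1)) * A + (f - (q + 1)).choose (m - (q + 1)) * B : ℕ) : ℚ) := by
      exact_mod_cast h
    push_cast at h'
    linarith
  have hre : ∑ m ∈ Finset.Icc (q + 1) d,
      (((f' - q).choose (m - (q + 1)) : ℚ) * (A : ℚ) + ((f - (q + 1)).choose (m - (q + 1)) : ℚ) * (B : ℚ)) /
        ((mult (m - q) : ℕ) : ℚ) =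
      ∑ j ∈ Finset.range (d - q),
      (((f' - q).choose j : ℚ) * (A : ℚ) + ((f - (q + 1)).choose j : ℚ) * (B : ℚ)) / ((mult (j + 1) : ℕ) : ℚ) := by
    rw [show Finset.Icc (q + 1) d = Finset.image (fun j => q + 1 + j) (Finset.range (d - q)) from ?_]
    · rw [Finset.sum_image (fun a _ b _ h => by omega)]
      apply Finset.sum_congr rfl
      intro j _
      rw [show q + 1 + j - (q + 1) = j by omega, show q + 1 + j - q = j + 1 by omega]
    · ext m
      rw [Finset.mem_Icc, Finset.mem_image]
      constructor
      · intro hm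
        exact ⟨m - (q + 1), by rw [Finset.mem_range]; omega, by omega⟩
      · rintro ⟨j, hj, rfl⟩
        rw [Finset.mem_range] at hj
        omega
  -- the two weights
  set Ws : ℚ := ∑ j ∈ Finset.range (d - q), (((f' - q).choose j : ℕ) : ℚ) / ((mult (j + 1) : ℕ) : ℚ) with hWsdef
  set Wb : ℚ := ∑ j ∈ Finset.range (d - q), (((f - (q + 1)).choose j : ℕ) : ℚ) / ((mult (j + 1) : ℕ) : ℚ) with hWbdef
  have hUq : (Matroid.topCount M p q : ℚ) ≤ ((p + d).choose q : ℚ) + (Ws * (A : ℚ) + Wb * (B : ℚ)) := by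
    have h1 : (Matroid.topCount M p q : ℚ) ≤ ((p + d).choose q : ℚ) +
        ∑ m ∈ Finset.Icc (q + 1) d, ({X : Set α | X ⊆ M.E ∧ M.eRk X = q ∧ X.ncard = m}.ncard : ℚ) := by
      have := hU1.trans hsum
      rw [hn] at this
      exact_mod_cast this
    have h2 : ∑ m ∈ Finset.Icc (q + 1) d, ({X : Set α | X ⊆ M.E ∧ M.eRk X = q ∧ X.ncard = m}.ncard : ℚ) ≤
        Ws * (A : ℚ) + Wb * (B : ℚ) := by
      rw [hWsdef, hWbdef, Finset.sum_mul, Finset.sum_mul, ← Finset.sum_add_distrib]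
      refine (Finset.sum_le_sum hlevel).trans (hre.le.trans ?_)
      apply le_of_eq
      apply Finset.sum_congr rfl
      intro j _
      ring
    linarith
  -- the weights in the shape of the hypothesis: `f' − q = μs − 1`, `f − (q + 1) = μb − 1`
  have hWs : Ws = ∑ j ∈ Finset.range (d - q), (((μs - 1).choose j : ℕ) : ℚ) / ((mult (j + 1) : ℕ) : ℚ) := by
    rw [hWsdef, show μs - 1 = f' - q by omega]
  have hWb : Wb = ∑ j ∈ Finset.range (d - q), (((μb - 1).choose j : ℕ) : ℚ) / ((mult (j + 1) : ℕ) : ℚ) := by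
    rw [hWbdef, show μb - 1 = f - (q + 1) by omega]
  -- (Y)
  have hY := Matroid.two_pow_le_midCount_add (M := M) p q hR
  have hAc : {X : Set α | X ⊆ M.E ∧ M.eRk X ≤ q}.ncard ≤ ∑ j ∈ Finset.range (q + d + 1), (p + d).choose j := by
    calc {X : Set α | X ⊆ M.E ∧ M.eRk X ≤ q}.ncard
        ≤ {X : Set α | X ⊆ (M.ground_finite.toFinset : Set α) ∧ X.ncard ≤ q + d}.ncard := by
          apply ncard_le_ncard
          · intro X hX
            exact ⟨by rw [Set.Finite.coe_toFinset]; exact hX.1, hcap X hX.1 q hX.2⟩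
          · exact (Finset.finite_toSet _).finite_subsets.subset (fun X hX => hX.1)
      _ ≤ ∑ j ∈ Finset.range (q + d + 1), M.ground_finite.toFinset.card.choose j :=
          ncard_subsets_ncard_le _ (q + d)
      _ = ∑ j ∈ Finset.range (q + d + 1), (p + d).choose j := by rw [hEcard]
  have hBc := Matroid.ncard_spanning_le (M := M) hd
  rw [hEcard] at hY hBc
  -- the tail `16·Σ_{j ≤ q+d} C(p+d, j) ≤ 2^{p+d}` is the hypothesis `hT`
  have hB' : ∑ j ∈ Finset.range (d + 1), (p + d).choose j ≤
      ∑ j ∈ Finset.range (q + d + 1), (p + d).choose j :=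
    Finset.sum_le_sum_of_subset_of_nonneg (Finset.range_mono (by omega)) (fun _ _ _ => Nat.zero_le _)
  have hAB : 8 * ({X : Set α | X ⊆ M.E ∧ M.eRk X ≤ q}.ncard +
      {X : Set α | X ⊆ M.E ∧ M.eRk X = M.eRank}.ncard) ≤ 2 ^ (p + d) := by
    have h2 := hBc.trans hB'
    omega
  -- (Φ) and the polynomial inequality
  have hΦ := phiK_le_two_pow_div p q
  rw [Nat.choose_symm_add] at hΦ
  have hpolyq := hpoly A B Ws Wb hWs hWb hA hB
  rw [add_assoc] at hpolyq
  -- assemble in `ℚ`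
  rw [RLS_iff]
  have hYq : (2 : ℚ) ^ (p + d) ≤ (Matroid.midCount M p q : ℚ) +
      ({X : Set α | X ⊆ M.E ∧ M.eRk X ≤ q}.ncard : ℚ) +
      ({X : Set α | X ⊆ M.E ∧ M.eRk X = M.eRank}.ncard : ℚ) := by exact_mod_cast hY
  have hABq : 8 * (({X : Set α | X ⊆ M.E ∧ M.eRk X ≤ q}.ncard : ℚ) +
      ({X : Set α | X ⊆ M.E ∧ M.eRk X = M.eRank}.ncard : ℚ)) ≤ 2 ^ (p + d) := by exact_mod_cast hAB
  have hU0 : (0 : ℚ) ≤ (Matroid.topCount M p q : ℚ) := Nat.cast_nonneg _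
  exact level_arith (p := p) (d := d) (n := p + d) (q := q) rfl (by omega) hΦ hU0 hUq hYq hABq hpolyq

end ThmN

end PercRepro
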